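import Literature.AnabelianGeometry.EtaleTheta.Discharge.Sec2RigidRowsAtModelTateInr
import Literature.AnabelianGeometry.EtaleTheta.Discharge.Sec2RigidityAtModelTate
import Literature.AnabelianGeometry.EtaleTheta.Discharge.Sec2Cor219iCoefficientAction
import Literature.AnabelianGeometry.EtaleTheta.Discharge.Sec2CyclotomicRigidityProofs
import Literature.AnabelianGeometry.EtaleTheta.Discharge.Sec2GalExtensionProofs
import Literature.AnabelianGeometry.EtaleTheta.Discharge.Sec2Prop214iiOfOrigin
import Literature.AnabelianGeometry.EtaleTheta.SettingModelTateCyclotomes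
import HarnessLib

/-!
# [EtTh] §2 rigidity nodes Prop. 2.14 (i), Cor. 2.18 (i), Cor. 2.18 (ii), Cor. 2.19 (i): the cone closers
# RE-CLOSED against the surviving instance form of their refuted-closure inputs AT THE TATE DATUM OF RECORD
# (C-R33 / K4; proof-only)

Mochizuki, *The Étale Theta Function and its Frobenioid-theoretic Manifestations* [EtTh], Publ. RIMS **45**
(2009), §2: Prop. 2.14 (i) PRIMS PDF p. 49, Cor. 2.18 (i) p. 60, Cor. 2.18 (ii) p. 60, Cor. 2.19 (i) p. 64; §1
Prop. 1.5 (ii), (iii) p. 23 (locators `p.N` = PDF pages of the PRIMS text; bib key `MochizukiEtTh2009`).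
Cell `abc-iut`, sub-cell R-C / L-K (D-0079), seat abc-iut-L2-t2 (gen 7; the [EtTh] §2 typer lineage of
`ThetaRigidity.lean` p404894, where the four node statements `RigidData.Prop214_i` / `.Cor218_i` / `.Cor218_ii` /
`.Cor219_i_splittings` were typed).  PROOF-ONLY: no definition, no instance, no notation, no new named fact;
nothing of another seat is edited or restated — every input is consumed BY NAME.

RULING C-R33 (abc-iut-plan g9, 2026-08-26T15:07:08Z): a cone node whose closing theorem binds a FACT-LIST row of
class «refuted-closure» as a hypothesis is discharged VACUOUSLY-AS-TYPED and does not count until it is re-closed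
against the row's surviving INSTANCE form.  abc-iut-c312-2's `CONE-K4-RECLOSE.tsv` v4 (18:48Z) lists, for layer L2,
the four [EtTh] §2 rigidity nodes of this lineage as RECLOSABLE with no lead evidence (rows 19, 20, 22, 38):

| K4 row | node | closers (CONE-FACT-SURGERY) | refuted-closure binders |
|---|---|---|---|
| 38 | EtTh:Prop2.14(i) | `RigidData.map_algImage_lDeltaTheta_le`, `DoubleUnderline.rigidData_prop214_i_of_origin` | F-0631 `h214i`, F-0591 `h15`, F-2498 `hO` |
| 20 | EtTh:Cor2.18(ii) | `DoubleUnderline.cor218_ii_of_model`, `rigidData_cor218_ii`, `_modAll`, `_of_H2`, `_of_origin` | F-0591 `h15`, F-2503 `h15ii`, F-2498 `hO` |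
| 22 | EtTh:Cor2.19(i) | `RigidData.iso_inMu_eq_coeffAut_of_cor219` | F-0626 `h219` |
| 19 | EtTh:Cor2.18(i) | `DoubleUnderline.rigidData_cor218_i_of_level` | F-0591 `h15`, F-0620 `h` (self / transport) |

THE DATUM OF RECORD.  At the Tate instance `ThetaSetting.modelχq p 1 2` of the stage-2 («Tate shear») model
(abc-iut-L2-t5), abc-iut-w5-d171's étale-theta datum `SettingModel.etaleThetaDataχqInr p` (class `η̈♯ = etaDdχq p 1 2`)
carries Prop. 1.5 (ii) AND (iii) as THEOREMS (`prop15ii_etaleThetaDataχqInr`, `prop15iii_etaleThetaDataχqInr`,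
`Discharge/Sec1Thm110ModelTateNV`), the guard `IsEtThOrigin` and the binder `hYcl` are theorems
(`ThetaSetting.modelχq_isEtThOrigin`, `SettingModel.hYcl_modelχq`), `Compat`/`Sec2Hyps` are theorems (abc-iut-L2-d1),
`X̲̲ := Huuχq` is an `E.DoubleUnderline l` for every odd `l` (`doubleUnderlineχqOfEtaRes` + `eta_res_etaDdχq`), and
`CyclotomeMod l N` is inhabited at every level (`modelχq_nonempty_cyclotomeMod`).  This is the instance at which
abc-iut-f-149 (`Sec2RigidityAtModelTate`) and abc-iut-f-153 (`Sec2RigidRowsAtModelTateInr`) already record the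
§2 FACT rows; this file writes the K4 RE-CLOSE siblings OF THE CLOSERS THEMSELVES there, binder for binder:

* §1 (row 38) `prop214_i_modelTate_inr` — F-0631 `RigidData.Prop214_i` for the rigidity data of the datum of record
  with NO `Prop` binder (= the closer `rigidData_prop214_i_of_origin` with `h15`, `hO`, `hYcl` SUPPLIED), and
  `map_algImage_lDeltaTheta_le_modelTate_inr` — the closer `RigidData.map_algImage_lDeltaTheta_le` with its head
  binder `h214i` (F-0631) GONE: for every bi-continuous `e` of the model environment stabilising `D_Y`,
  `Δ^tp_Y[μ_N]` and `s^alg(Ker ↠ Θ)`, `e(s^alg(l·Δ_Θ)) ≤ s^alg(l·Δ_Θ)`;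
* §2 (row 20) `cor218_ii_of_model_modelTate_inr` — the closer `cor218_ii_of_model` with `h15`, `h15ii` AND the
  2-torsion binder `H2` GONE (the latter by abc-iut-w6-d035's `CyclotomeMod.red_eq_one_of_sq_eq_one_of_origin` at the
  guard): every `RigidData` whose `ThetaEnvData` IS the model environment of the datum satisfies Cor. 2.18 (ii);
  `rigidData_cor218_ii_mod_modelTate_inr` / `rigidData_cor218_ii_modAll_modelTate_inr` — the closers
  `rigidData_cor218_ii` (chain levels `τ.mod M`) / `rigidData_cor218_ii_modAll` (all levels `τ.modAll M`) binder-free;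
  the single-level closers `_of_H2` / `_of_origin` are re-closed by abc-iut-f-153's pre-existing
  `cor218_ii_modelTate_inr` (every `μ`), cited not restated;
* §3 (row 22) `cor219_i_splittings_modelTate_inr_of_cor218_i` — F-0626 at the datum of record modulo the ONE
  residual `h218i : Cor218_i` of the same rigidity data (F-0620 AT THE DATUM — abc-iut-L6-d6's row O2; temp-slimness
  and Prop. 2.14 (i) are theorems here), and `iso_inMu_eq_coeffAut_modelTate_inr_of_cor218_i` — the closer
  `RigidData.iso_inMu_eq_coeffAut_of_cor219` RE-KEYED from `h219` (F-0626) onto that residual: every automorphism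
  of `M_η` over `γ` acts on `μ_N` through the coefficient automorphism `γ̄_μ` — INSTANCE-CONDITIONAL, not re-closed;
* §4 (row 19) `cor218_i_of_level_modelTate_inr` — the level-transport closer `rigidData_cor218_i_of_level` at the
  datum with `h15` GONE; its remaining binder is F-0620 at the SOURCE level (a transport premise — the row itself);
* §5 non-vacuity: `exists_rigidData_prop214_i_and_cor218_ii_modelTate` — for every odd `l` and every level `N`
  there EXIST `E`, `X̲̲`, `μ`, `L` over `modelχq p 1 2` with `η̈♯ = etaDdχq`, `Π^tp_X̲̲ = Huuχq`, for which
  Prop. 2.14 (i) and Cor. 2.18 (ii) HOLD for `C.rigidData μ … L` (so §1–§2 are not statements about an empty family),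
  and `sec2_rigidity_nodes_reclosed_modelTate_inr` — the census conjunction of the four nodes at the datum:
  Prop. 2.14 (i) ∧ Cor. 2.18 (ii) outright, Cor. 2.19 (i) (both splittings) given Cor. 2.18 (i) there.

HONEST LABEL: `modelχq` is a SEMI-SYNTHETIC model of the typed §1 interface (the Tate-sheared χ-twisted root
datum; not the tempered `π₁` of a curve) — consistency / non-vacuity evidence and the kernel record that these
closers are NOT vacuous in their refuted-closure binders; the universal closures of F-0631 / F-0626 / F-0620 stay
REFUTED over the lawless interface (abc-iut-w5-d175 `RigidData.Toy.not_forall_*`) — refuted-as-typed ≠ refuted-in-print;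
Cor. 2.18 (i) at the datum (F-0620, O2) is displayed as a binder and NOT asserted; nothing of [EtTh] (refereed) is
asserted beyond the displayed statements; no side is taken on [IUTchIII] Cor. 3.12; typed ≠ proved; re-closed ≠
endorsed; a FACT row is an assumption label, not an endorsement.
-/

noncomputable section

namespace Literature.AnabelianGeometry.EtaleTheta.SettingModel

open Literature.AnabelianGeometry.SemiGraphs
open Literature.AlgebraicGeometry.Frobenioids (IsSlimGroup)

variable (p : ℕ) [Fact p.Prime]
variable {l : ℕ} (C : (etaleThetaDataχqInr p).DoubleUnderline l) {N : ℕ+}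
  (μ : (ThetaSetting.modelχq p 1 2 even_two).CyclotomeMod l N) {Es : Set ℕ+}
  (τ : (ThetaSetting.modelχq p 1 2 even_two).CyclotomeTower l Es)

/-! ## §1. Node EtTh:Prop2.14(i) (K4 row 38): F-0631 binder-free; the closer re-keyed -/

/-- **F-0631 [EtTh] Prop. 2.14 (i) for the rigidity data of the datum OF RECORD at the Tate instance — NO `Prop`
binder** (p. 49: "the subset `{γ(β)·β⁻¹·k}` … coincides with the image of the algebraic section over `l·Δ_Θ`"):
abc-iut-f-149's `rigidData_prop214_i_modelχq` — i.e. the cone closer `rigidData_prop214_i_of_origin` with its three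
K4 binders SUPPLIED: `h15` := abc-iut-w5-d171's `prop15iii_etaleThetaDataχqInr` (F-0591), `hO` :=
`modelχq_isEtThOrigin` (F-2498), `hYcl` := `hYcl_modelχq`.  Binders left = data `C`, `μ`, `L`.
[cite: MochizukiEtTh2009, Prop 2.14 (i) p.49] -/
theorem prop214_i_modelTate_inr (L : C.CuspLabels) :
    Literature.AnabelianGeometry.EtaleTheta.RigidData.Prop214_i
      (C.rigidData μ (compat_modelχq p 1 2 even_two) (ThetaSetting.modelχq_sec2Hyps p 1 2 even_two)
        (prop15iii_etaleThetaDataχqInr p _) L) :=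
  rigidData_prop214_i_modelχq p 1 2 even_two C μ _ _ (prop15iii_etaleThetaDataχqInr p _) L

/-- **The cone closer `RigidData.map_algImage_lDeltaTheta_le` RE-CLOSED at the datum of record (C-R33 / K4 row 38)**:
its head binder `h214i : R.Prop214_i` (F-0631, refuted as a universal closure over the lawless interface) is
SUPPLIED by `prop214_i_modelTate_inr`, for `R` the rigidity data of the datum of record at any level `μ` and
labelling `L` — «for any bi-continuous `e` of `Π•[μ_N]` over which `D_Y`, `Δ^tp_Y[μ_N]` and `s^alg(Ker(Π^tp_Y̲̲ ↠ Θ))`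
are invariant, `e(s^alg(l·Δ_Θ)) ⊆ s^alg(l·Δ_Θ)`» (the Prop. 2.14 (i) half of cyclotomic rigidity, p. 65).  Remaining
hypotheses = the closer's own `e`, `hD`, `hΔ`, `hK` — no FACT-LIST row. [cite: MochizukiEtTh2009, Cor 2.19(i) p.65] -/
theorem map_algImage_lDeltaTheta_le_modelTate_inr (L : C.CuspLabels)
    (e : (C.rigidData μ (compat_modelχq p 1 2 even_two) (ThetaSetting.modelχq_sec2Hyps p 1 2 even_two)
        (prop15iii_etaleThetaDataχqInr p _) L).env ≃ₜ*
      (C.rigidData μ (compat_modelχq p 1 2 even_two) (ThetaSetting.modelχq_sec2Hyps p 1 2 even_two)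
        (prop15iii_etaleThetaDataχqInr p _) L).env)
    (hD : (C.rigidData μ (compat_modelχq p 1 2 even_two) (ThetaSetting.modelχq_sec2Hyps p 1 2 even_two)
        (prop15iii_etaleThetaDataχqInr p _) L).DY.map (TopOut.transport e) =
      (C.rigidData μ (compat_modelχq p 1 2 even_two) (ThetaSetting.modelχq_sec2Hyps p 1 2 even_two)
        (prop15iii_etaleThetaDataχqInr p _) L).DY)
    (hΔ : (CycEnvelope.deltaEnv
          (C.rigidData μ (compat_modelχq p 1 2 even_two) (ThetaSetting.modelχq_sec2Hyps p 1 2 even_two)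
            (prop15iii_etaleThetaDataχqInr p _) L).augY
          (C.rigidData μ (compat_modelχq p 1 2 even_two) (ThetaSetting.modelχq_sec2Hyps p 1 2 even_two)
            (prop15iii_etaleThetaDataχqInr p _) L).chi).map e.toMulEquiv.toMonoidHom =
      CycEnvelope.deltaEnv
        (C.rigidData μ (compat_modelχq p 1 2 even_two) (ThetaSetting.modelχq_sec2Hyps p 1 2 even_two)
          (prop15iii_etaleThetaDataχqInr p _) L).augY
        (C.rigidData μ (compat_modelχq p 1 2 even_two) (ThetaSetting.modelχq_sec2Hyps p 1 2 even_two)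
          (prop15iii_etaleThetaDataχqInr p _) L).chi)
    (hK : ((C.rigidData μ (compat_modelχq p 1 2 even_two) (ThetaSetting.modelχq_sec2Hyps p 1 2 even_two)
            (prop15iii_etaleThetaDataχqInr p _) L).algImage
          (C.rigidData μ (compat_modelχq p 1 2 even_two) (ThetaSetting.modelχq_sec2Hyps p 1 2 even_two)
            (prop15iii_etaleThetaDataχqInr p _) L).thetaKer).map e.toMulEquiv.toMonoidHom =
      (C.rigidData μ (compat_modelχq p 1 2 even_two) (ThetaSetting.modelχq_sec2Hyps p 1 2 even_two)
          (prop15iii_etaleThetaDataχqInr p _) L).algImage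
        (C.rigidData μ (compat_modelχq p 1 2 even_two) (ThetaSetting.modelχq_sec2Hyps p 1 2 even_two)
          (prop15iii_etaleThetaDataχqInr p _) L).thetaKer) :
    ((C.rigidData μ (compat_modelχq p 1 2 even_two) (ThetaSetting.modelχq_sec2Hyps p 1 2 even_two)
          (prop15iii_etaleThetaDataχqInr p _) L).algImage
        (C.rigidData μ (compat_modelχq p 1 2 even_two) (ThetaSetting.modelχq_sec2Hyps p 1 2 even_two)
          (prop15iii_etaleThetaDataχqInr p _) L).lDeltaTheta).map e.toMulEquiv.toMonoidHom ≤
      (C.rigidData μ (compat_modelχq p 1 2 even_two) (ThetaSetting.modelχq_sec2Hyps p 1 2 even_two)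
          (prop15iii_etaleThetaDataχqInr p _) L).algImage
        (C.rigidData μ (compat_modelχq p 1 2 even_two) (ThetaSetting.modelχq_sec2Hyps p 1 2 even_two)
          (prop15iii_etaleThetaDataχqInr p _) L).lDeltaTheta :=
  (C.rigidData μ (compat_modelχq p 1 2 even_two) (ThetaSetting.modelχq_sec2Hyps p 1 2 even_two)
      (prop15iii_etaleThetaDataχqInr p _) L).map_algImage_lDeltaTheta_le (prop214_i_modelTate_inr p C μ L) e hD hΔ hK

/-! ## §2. Node EtTh:Cor2.18(ii) (K4 row 20): the closers with `h15`, `h15ii`, `H2`, `hO` gone -/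

/-- **The cone closer `DoubleUnderline.cor218_ii_of_model` RE-CLOSED at the datum of record (C-R33 / K4 row 20)**
([EtTh] Cor. 2.18 (ii), p. 60: "precisely the content of Prop. 2.14 (ii)" — every `δ` extends, `α_δ` preserves `D_Y`):
EVERY rigidity datum `R` whose underlying `ThetaEnvData` IS the model mono-theta environment of the datum of record at
level `μ` satisfies `R.Cor218_ii`; the closer's binders `h15` (F-0591), `h15ii` (F-2503) are abc-iut-w5-d171's theorems
and its 2-torsion binder `H2` is abc-iut-w6-d035's `CyclotomeMod.red_eq_one_of_sq_eq_one_of_origin` at the guard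
`modelχq_isEtThOrigin` (F-2498).  Remaining hypotheses: data `C`, `μ`, `R`, and the identification `hR`.
[cite: MochizukiEtTh2009, Cor 2.18 (ii) p.60] -/
theorem cor218_ii_of_model_modelTate_inr (R : Literature.AnabelianGeometry.EtaleTheta.RigidData.{0} N l)
    (hR : R.toThetaEnvData =
      C.thetaEnvData μ (compat_modelχq p 1 2 even_two) (ThetaSetting.modelχq_sec2Hyps p 1 2 even_two)) :
    R.Cor218_ii :=
  C.cor218_ii_of_model μ _ _ (prop15iii_etaleThetaDataχqInr p _) (prop15ii_etaleThetaDataχqInr p _)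
    (fun t ht => μ.red_eq_one_of_sq_eq_one_of_origin _ (ThetaSetting.modelχq_isEtThOrigin p 1 2 even_two) t ht) R hR

/-- **The cone closer `DoubleUnderline.rigidData_cor218_ii` RE-CLOSED at the datum of record**: at every CHAIN level
`τ.mod M` (`M ∈ E`) of a cyclotome tower of the Tate instance, Cor. 2.18 (ii) HOLDS for the rigidity data of the datum
of record — binders `h15`, `h15ii` SUPPLIED; left = data `C`, `τ`, `M`, `L`. [cite: MochizukiEtTh2009, Cor 2.18 (ii) p.60] -/
theorem rigidData_cor218_ii_mod_modelTate_inr (M : Es) (L : C.CuspLabels) :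
    Literature.AnabelianGeometry.EtaleTheta.RigidData.Cor218_ii
      (C.rigidData (τ.mod M) (compat_modelχq p 1 2 even_two) (ThetaSetting.modelχq_sec2Hyps p 1 2 even_two)
        (prop15iii_etaleThetaDataχqInr p _) L) :=
  C.rigidData_cor218_ii τ M _ _ (prop15iii_etaleThetaDataχqInr p _) (prop15ii_etaleThetaDataχqInr p _) L

/-- **The cone closer `DoubleUnderline.rigidData_cor218_ii_modAll` RE-CLOSED at the datum of record**: at EVERY
level `M ∈ ℕ≥1` (identification `τ.modAll M`), Cor. 2.18 (ii) HOLDS for the rigidity data of the datum of record —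
binders `h15`, `h15ii` SUPPLIED (the `RigidData`-currency twin of abc-iut-f-153's `thetaEnvData_cor218_ii_modelTate_inr_modAll`).
[cite: MochizukiEtTh2009, Cor 2.18 (ii) p.60] -/
theorem rigidData_cor218_ii_modAll_modelTate_inr (M : ℕ+) (L : C.CuspLabels) :
    Literature.AnabelianGeometry.EtaleTheta.RigidData.Cor218_ii
      (C.rigidData (τ.modAll M) (compat_modelχq p 1 2 even_two) (ThetaSetting.modelχq_sec2Hyps p 1 2 even_two)
        (prop15iii_etaleThetaDataχqInr p _) L) :=
  C.rigidData_cor218_ii_modAll τ M _ _ (prop15iii_etaleThetaDataχqInr p _) (prop15ii_etaleThetaDataχqInr p _) L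

/-- The single-level closers `rigidData_cor218_ii_of_H2` / `rigidData_cor218_ii_of_origin` are re-closed at the datum
of record by abc-iut-f-153's PRE-EXISTING `cor218_ii_modelTate_inr` (every level `μ`, every labelling): recorded here
BY NAME as the K4 sibling of record, not restated. [cite: MochizukiEtTh2009, Cor 2.18 (ii) p.60] -/
example (L : C.CuspLabels) :
    Literature.AnabelianGeometry.EtaleTheta.RigidData.Cor218_ii
      (C.rigidData μ (compat_modelχq p 1 2 even_two) (ThetaSetting.modelχq_sec2Hyps p 1 2 even_two)
        (prop15iii_etaleThetaDataχqInr p _) L) :=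
  cor218_ii_modelTate_inr p C μ L

/-! ## §3. Node EtTh:Cor2.19(i) (K4 row 22): F-0626 and its closer, modulo Cor. 2.18 (i) at the datum ONLY -/

/-- **F-0626 [EtTh] Cor. 2.19 (i), both splittings, for the rigidity data of the datum OF RECORD, modulo the ONE
residual `h218i`** (p. 64: every automorphism of `M_η` preserves `s^alg(l·Δ_Θ)` and `s^Θ_η(l·Δ_Θ)`): abc-iut-f-149's
`cor219_i_splittings_modelχq` (temp-slimness `isSlimGroup_piTemp_modelχq` and Prop. 2.14 (i) are THEOREMS at the
stage-2 record) with `h15` := abc-iut-w5-d171's theorem.  The displayed binder `h218i` is FACT row F-0620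
([EtTh] Cor. 2.18 (i)) AT THIS DATUM — abc-iut-L6-d6's open row O2; it is NOT asserted here.
[cite: MochizukiEtTh2009, Cor 2.19 (i) p.64] -/
theorem cor219_i_splittings_modelTate_inr_of_cor218_i (L : C.CuspLabels)
    (h218i : (C.rigidData μ (compat_modelχq p 1 2 even_two) (ThetaSetting.modelχq_sec2Hyps p 1 2 even_two)
      (prop15iii_etaleThetaDataχqInr p _) L).Cor218_i) :
    Literature.AnabelianGeometry.EtaleTheta.RigidData.Cor219_i_splittings
      (C.rigidData μ (compat_modelχq p 1 2 even_two) (ThetaSetting.modelχq_sec2Hyps p 1 2 even_two)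
        (prop15iii_etaleThetaDataχqInr p _) L) :=
  cor219_i_splittings_modelχq p 1 2 even_two C μ _ _ (prop15iii_etaleThetaDataχqInr p _) L h218i

/-- **The cone closer `RigidData.iso_inMu_eq_coeffAut_of_cor219` RE-KEYED at the datum of record (C-R33 / K4 row 22)**:
its head binder `h219 : R.Cor219_i_splittings` (F-0626) is REPLACED by Cor. 2.18 (i) at the datum (`h218i`, F-0620 —
the one residual of §3), for `R` the rigidity data of the datum of record: every automorphism `α` of the model
mono-theta environment `M_η` lying over `γ ∈ Aut(Π^tp_X̲̲)` acts on `μ_N` through the coefficient automorphism `γ̄_μ`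
of `γ` — `α(ι(a)) = ι(γ̄_μ(a))` (p. 64).  INSTANCE-CONDITIONAL: the remaining FACT binder is F-0620 at the datum.
[cite: MochizukiEtTh2009, Cor 2.19 (i) p.64] -/
theorem iso_inMu_eq_coeffAut_modelTate_inr_of_cor218_i (L : C.CuspLabels)
    (h218i : (C.rigidData μ (compat_modelχq p 1 2 even_two) (ThetaSetting.modelχq_sec2Hyps p 1 2 even_two)
      (prop15iii_etaleThetaDataχqInr p _) L).Cor218_i)
    {η : (C.rigidData μ (compat_modelχq p 1 2 even_two) (ThetaSetting.modelχq_sec2Hyps p 1 2 even_two)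
        (prop15iii_etaleThetaDataχqInr p _) L).PiYdd →
      (C.rigidData μ (compat_modelχq p 1 2 even_two) (ThetaSetting.modelχq_sec2Hyps p 1 2 even_two)
        (prop15iii_etaleThetaDataχqInr p _) L).mu}
    (hη : η ∈ (C.rigidData μ (compat_modelχq p 1 2 even_two) (ThetaSetting.modelχq_sec2Hyps p 1 2 even_two)
      (prop15iii_etaleThetaDataχqInr p _) L).thetaCocycles)
    (α : ((C.rigidData μ (compat_modelχq p 1 2 even_two) (ThetaSetting.modelχq_sec2Hyps p 1 2 even_two)
          (prop15iii_etaleThetaDataχqInr p _) L).modelMono hη).Iso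
      ((C.rigidData μ (compat_modelχq p 1 2 even_two) (ThetaSetting.modelχq_sec2Hyps p 1 2 even_two)
          (prop15iii_etaleThetaDataχqInr p _) L).modelMono hη))
    (γ : (C.rigidData μ (compat_modelχq p 1 2 even_two) (ThetaSetting.modelχq_sec2Hyps p 1 2 even_two)
          (prop15iii_etaleThetaDataχqInr p _) L).PiX ≃*
      (C.rigidData μ (compat_modelχq p 1 2 even_two) (ThetaSetting.modelχq_sec2Hyps p 1 2 even_two)
          (prop15iii_etaleThetaDataχqInr p _) L).PiX)
    (hαγ : ∀ x : (C.rigidData μ (compat_modelχq p 1 2 even_two) (ThetaSetting.modelχq_sec2Hyps p 1 2 even_two)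
          (prop15iii_etaleThetaDataχqInr p _) L).env,
      ((CycEnvelope.proj
          (C.rigidData μ (compat_modelχq p 1 2 even_two) (ThetaSetting.modelχq_sec2Hyps p 1 2 even_two)
            (prop15iii_etaleThetaDataχqInr p _) L).augY
          (C.rigidData μ (compat_modelχq p 1 2 even_two) (ThetaSetting.modelχq_sec2Hyps p 1 2 even_two)
            (prop15iii_etaleThetaDataχqInr p _) L).chi (α.e x) :
          (C.rigidData μ (compat_modelχq p 1 2 even_two) (ThetaSetting.modelχq_sec2Hyps p 1 2 even_two)
            (prop15iii_etaleThetaDataχqInr p _) L).PiY) :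
          (C.rigidData μ (compat_modelχq p 1 2 even_two) (ThetaSetting.modelχq_sec2Hyps p 1 2 even_two)
            (prop15iii_etaleThetaDataχqInr p _) L).PiX) =
        γ ((CycEnvelope.proj
          (C.rigidData μ (compat_modelχq p 1 2 even_two) (ThetaSetting.modelχq_sec2Hyps p 1 2 even_two)
            (prop15iii_etaleThetaDataχqInr p _) L).augY
          (C.rigidData μ (compat_modelχq p 1 2 even_two) (ThetaSetting.modelχq_sec2Hyps p 1 2 even_two)
            (prop15iii_etaleThetaDataχqInr p _) L).chi x :
          (C.rigidData μ (compat_modelχq p 1 2 even_two) (ThetaSetting.modelχq_sec2Hyps p 1 2 even_two)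
            (prop15iii_etaleThetaDataχqInr p _) L).PiY) :
          (C.rigidData μ (compat_modelχq p 1 2 even_two) (ThetaSetting.modelχq_sec2Hyps p 1 2 even_two)
            (prop15iii_etaleThetaDataχqInr p _) L).PiX))
    (γμ : (C.rigidData μ (compat_modelχq p 1 2 even_two) (ThetaSetting.modelχq_sec2Hyps p 1 2 even_two)
          (prop15iii_etaleThetaDataχqInr p _) L).mu ≃*
      (C.rigidData μ (compat_modelχq p 1 2 even_two) (ThetaSetting.modelχq_sec2Hyps p 1 2 even_two)
          (prop15iii_etaleThetaDataχqInr p _) L).mu)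
    (hγμ : ∀ (g : (C.rigidData μ (compat_modelχq p 1 2 even_two) (ThetaSetting.modelχq_sec2Hyps p 1 2 even_two)
          (prop15iii_etaleThetaDataχqInr p _) L).lDeltaTheta)
        (hg' : γ g ∈ (C.rigidData μ (compat_modelχq p 1 2 even_two) (ThetaSetting.modelχq_sec2Hyps p 1 2 even_two)
          (prop15iii_etaleThetaDataχqInr p _) L).lDeltaTheta),
      (C.rigidData μ (compat_modelχq p 1 2 even_two) (ThetaSetting.modelχq_sec2Hyps p 1 2 even_two)
          (prop15iii_etaleThetaDataχqInr p _) L).thetaMod ⟨γ g, hg'⟩ =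
        γμ ((C.rigidData μ (compat_modelχq p 1 2 even_two) (ThetaSetting.modelχq_sec2Hyps p 1 2 even_two)
          (prop15iii_etaleThetaDataχqInr p _) L).thetaMod g))
    (a : (C.rigidData μ (compat_modelχq p 1 2 even_two) (ThetaSetting.modelχq_sec2Hyps p 1 2 even_two)
          (prop15iii_etaleThetaDataχqInr p _) L).mu) :
    α.e (CycEnvelope.inMu
        (C.rigidData μ (compat_modelχq p 1 2 even_two) (ThetaSetting.modelχq_sec2Hyps p 1 2 even_two)
          (prop15iii_etaleThetaDataχqInr p _) L).augY
        (C.rigidData μ (compat_modelχq p 1 2 even_two) (ThetaSetting.modelχq_sec2Hyps p 1 2 even_two)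
          (prop15iii_etaleThetaDataχqInr p _) L).chi a) =
      CycEnvelope.inMu
        (C.rigidData μ (compat_modelχq p 1 2 even_two) (ThetaSetting.modelχq_sec2Hyps p 1 2 even_two)
          (prop15iii_etaleThetaDataχqInr p _) L).augY
        (C.rigidData μ (compat_modelχq p 1 2 even_two) (ThetaSetting.modelχq_sec2Hyps p 1 2 even_two)
          (prop15iii_etaleThetaDataχqInr p _) L).chi (γμ a) :=
  Literature.AnabelianGeometry.EtaleTheta.RigidData.iso_inMu_eq_coeffAut_of_cor219
    (cor219_i_splittings_modelTate_inr_of_cor218_i p C μ L h218i) hη α γ hαγ γμ hγμ a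

/-! ## §4. Node EtTh:Cor2.18(i) (K4 row 19): the level-transport closer with `h15` gone -/

/-- **The cone closer `DoubleUnderline.rigidData_cor218_i_of_level` RE-CLOSED at the datum of record (C-R33 / K4
row 19)**: Cor. 2.18 (i) for the rigidity data of the datum of record TRANSFERS verbatim between any two levels
`μ`, `μ'` (the statement is level-free, p. 60) — binder `h15` (F-0591) SUPPLIED by abc-iut-w5-d171's theorem; the
remaining binder `h` is F-0620 at the SOURCE level, a transport PREMISE (c312-2: «self»), not an extra assumption.
[cite: MochizukiEtTh2009, Cor 2.18 (i) p.60] -/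
theorem cor218_i_of_level_modelTate_inr {N' : ℕ+} (μ' : (ThetaSetting.modelχq p 1 2 even_two).CyclotomeMod l N')
    (L : C.CuspLabels)
    (h : (C.rigidData μ (compat_modelχq p 1 2 even_two) (ThetaSetting.modelχq_sec2Hyps p 1 2 even_two)
      (prop15iii_etaleThetaDataχqInr p _) L).Cor218_i) :
    (C.rigidData μ' (compat_modelχq p 1 2 even_two) (ThetaSetting.modelχq_sec2Hyps p 1 2 even_two)
      (prop15iii_etaleThetaDataχqInr p _) L).Cor218_i :=
  C.rigidData_cor218_i_of_level μ μ' _ _ (prop15iii_etaleThetaDataχqInr p _) L h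

/-! ## §5. Non-vacuity and the census conjunction -/

/-- **NON-VACUITY of §1–§4**: for every ODD `l` and every level `N ∈ ℕ≥1` there EXIST, over the Tate instance
`modelχq p 1 2`, an étale-theta datum `E` carrying the class of record `η̈♯ = etaDdχq p 1 2`, a choice `X̲̲` with
`Π^tp_X̲̲ = Huuχq p 1 2 l`, a level-`N` cyclotome identification `μ`, a cusp labelling `L` and a proof `h15` of
Prop. 1.5 (iii) for `E`, such that Prop. 2.14 (i) AND Cor. 2.18 (ii) HOLD for `C.rigidData μ … h15 L` — witnesses
`etaleThetaDataχqInr` (abc-iut-w5-d171), `doubleUnderlineχqOfEtaRes` + `eta_res_etaDdχq` (abc-iut-L2-d1),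
`modelχq_nonempty_cyclotomeMod` (abc-iut-L2-t8), the empty labelling, `prop15iii_etaleThetaDataχqInr`.
[cite: MochizukiEtTh2009, Prop 2.14 (i) p.49] -/
theorem exists_rigidData_prop214_i_and_cor218_ii_modelTate (l : ℕ+) (hl : Odd (l : ℕ)) (N : ℕ+) :
    ∃ (E : (ThetaSetting.modelχq p 1 2 even_two).EtaleThetaData) (C : E.DoubleUnderline l)
      (μ : (ThetaSetting.modelχq p 1 2 even_two).CyclotomeMod l N) (L : C.CuspLabels)
      (h15 : ThetaSetting.Prop15iii E (compat_modelχq p 1 2 even_two)),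
      E.etaDd = etaDdχq p 1 2 even_two ∧ C.Huu = Huuχq p 1 2 l hl ∧
        Literature.AnabelianGeometry.EtaleTheta.RigidData.Prop214_i
          (C.rigidData μ (compat_modelχq p 1 2 even_two) (ThetaSetting.modelχq_sec2Hyps p 1 2 even_two) h15 L) ∧
        Literature.AnabelianGeometry.EtaleTheta.RigidData.Cor218_ii
          (C.rigidData μ (compat_modelχq p 1 2 even_two) (ThetaSetting.modelχq_sec2Hyps p 1 2 even_two) h15 L) := by
  obtain ⟨μ⟩ := modelχq_nonempty_cyclotomeMod p 1 2 even_two l.pos N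
  exact ⟨etaleThetaDataχqInr p,
    (etaleThetaDataχqInr p).doubleUnderlineχqOfEtaRes p 1 2 l hl (eta_res_etaDdχq p 1 2 even_two l hl), μ,
    ⟨fun _ => ∅, fun _ => ∅, fun _ => rfl⟩, prop15iii_etaleThetaDataχqInr p _, rfl, rfl,
    prop214_i_modelTate_inr p _ μ _, cor218_ii_modelTate_inr p _ μ _⟩

/-- **THE FOUR §2 RIGIDITY NODES OF THIS LINEAGE AT THE DATUM OF RECORD** (Tate instance `modelχq p 1 2`,
étale-theta datum `etaleThetaDataχqInr p`, every `X̲̲`-choice `C`, level `μ`, cusp labelling `L`): Prop. 2.14 (i)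
(F-0631) ∧ Cor. 2.18 (ii) (F-0621) HOLD outright, and Cor. 2.19 (i) (F-0626, both splittings) HOLDS given Cor. 2.18 (i)
(F-0620) for the same data — the residual of the block is that one instance question.
[cite: MochizukiEtTh2009, Cor 2.19 (i) p.64] -/
theorem sec2_rigidity_nodes_reclosed_modelTate_inr (L : C.CuspLabels) :
    Literature.AnabelianGeometry.EtaleTheta.RigidData.Prop214_i
        (C.rigidData μ (compat_modelχq p 1 2 even_two) (ThetaSetting.modelχq_sec2Hyps p 1 2 even_two)
          (prop15iii_etaleThetaDataχqInr p _) L) ∧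
      Literature.AnabelianGeometry.EtaleTheta.RigidData.Cor218_ii
        (C.rigidData μ (compat_modelχq p 1 2 even_two) (ThetaSetting.modelχq_sec2Hyps p 1 2 even_two)
          (prop15iii_etaleThetaDataχqInr p _) L) ∧
      ((C.rigidData μ (compat_modelχq p 1 2 even_two) (ThetaSetting.modelχq_sec2Hyps p 1 2 even_two)
          (prop15iii_etaleThetaDataχqInr p _) L).Cor218_i →
        Literature.AnabelianGeometry.EtaleTheta.RigidData.Cor219_i_splittings
          (C.rigidData μ (compat_modelχq p 1 2 even_two) (ThetaSetting.modelχq_sec2Hyps p 1 2 even_two)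
            (prop15iii_etaleThetaDataχqInr p _) L)) :=
  ⟨prop214_i_modelTate_inr p C μ L, cor218_ii_modelTate_inr p C μ L,
    fun h218i => cor219_i_splittings_modelTate_inr_of_cor218_i p C μ L h218i⟩

end Literature.AnabelianGeometry.EtaleTheta.SettingModel

end
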